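/-
Copyright: the b2b-balaban T⁴-continuum CRUX team, row NE7b OWNER lineage `t4-ne7b-p1` (gen 127). Project licence.
-/
import Summits.QuantumFields.BalabanUV.T4Continuum.Spine.NE7b.SupFibreFiniteRangeRemainder
import Summits.QuantumFields.BalabanUV.T4Continuum.Spine.NE7b.SupTorusFibreGaussianCovariance
import Summits.QuantumFields.BalabanUV.T4Continuum.Spine.NE7b.SupTorusFibreChartLocal
import Summits.QuantumFields.BalabanUV.T4Continuum.Spine.NE7b.SupTorusBlockDistance

/-!
# THE TORUS INSTANCE OF THE FINITE-RANGE DECOMPOSITION: on the fine torus `(ℤ∕(n+1)s)^d`, AT ANY FIELD `φ` of the road's class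
# (`−λ ≤ u″(φ x) ≤ Λ`, `λ < min(2,a)`, `a > 0`), the fluctuation covariance `C_φ` of (274) — THE inverse of (101)'s fluctuation operator on
# the zero-block-mean fibre — splits for every `J` as `C_φ = Σ_{N<J} Γ_N + Γ_J^{rem}` with every `Γ_N` POSITIVE SEMIDEFINITE and of RANGE
# `2(2^N − 1)` IN TORUS BLOCK DISTANCE and `Γ_J^{rem}` positive semidefinite: the road's linearised form has block range one
# (`torus_operator_apply`: a bond step moves the block by at most one, the block-averaging term stays in the block), (279)'s chart is
# block-local, and (273)∕(278) apply BY NAME (row NE7b, node U5c; (271)∕(273)∕(274)∕(278)∕(279) + (86)∕(89)∕(106) BY NAME; [folklore])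

Cell `pub-balaban`, sub-cell `t4`, spine estimate NE7b (`T4WeightBudget.RelWeightBound`; the cell's OWN estimate — NOT PRINTED in
[Bałaban 1983–89], NOT PROVED).  Crux-route work under `Spine/NE7b/` by the row OWNER (`t4-ne7b-p1` gen 127, file (281)) under FREEZE
(0)'s crux-prover clause, on § [NE7bP1-G126-HANDOFF] NEXT (3)(d); NOTHING of Bałaban's is named as a Lean object, valued or asserted; no
`T4Continuum/Support` leaf typed; no `def`, no notation (the block distance is the displayed `Σ_i |valMinAbs(·)|` of torus blocks); zero
`sorry`.  Imports (BY NAME): the OWNER's (278) `…SupFibreFiniteRangeRemainder` (`fibre_covariance_frd_psd`), (274)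
`…SupTorusFibreGaussianCovariance` (`torus_linearised_form`), (279) `…SupTorusFibreChartLocal` (`exists_fibreChart_local`), (131)
`…SupTorusBlockDistance` (`natAbs_valMinAbs_le_of_intCast_eq`, `natAbs_valMinAbs_add_le'`), (271) `covariance_mem_fibre`,
`covariance_fibre_equation`; the lineage's (89) `torus_operator_apply`, (106) `torus_form_ceiling`, (86) `blockOf_siteOf`,
`blockOf_siteOf_of_mem`; the tree's `Beta.siteOf_add`∕`siteOf_windowMap`, `B6QGQLower276.chart_mem_B`, Mathlib's `ZMod.natAbs_valMinAbs_neg`.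

WHY (located).  (273)∕(278) are stated for ANY local chart and ANY form of finite range in ANY pseudo-distance; this file checks the
road supplies them on the torus with the NATURAL distance — the `ℓ¹` torus distance between BLOCKS — in which the chart has radius `0`
(the chart field of the index `(y, t)` lives in block `y`) and the linearised operator `A_t + u″(φ)` has range `1` (nearest-neighbour
Laplacian + block averaging + a diagonal), with the volume-free ceiling `4d(n+1)² + a + Λ` of (106).  So the road's fluctuation field at
every background is, in chart coordinates, a sum of `J + 1` independent centred Gaussian fields ((280)), `J` of them of finite block range
((276) turns each into a finite-range-dependent reference for the tree's polymer gas).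

WHAT IS PROVED ([folklore]; the `Beta.Site` carriers, `A_t = Rf∘Aop∘Ef`, `Q′t = Rc∘Dop∘Ef`, torus block `tb x = σ_s(blk n (wm x))`,
block distance `ρ(u,v) = Σ_i |valMinAbs(u_i − v_i)|`):
* §1 `blockDist_triangle`, `blockDist_comm`, `blockDist_self` (`ρ` is an `ℕ`-valued pseudo-distance on `Site d s`).
* §2 `blk_step_le_one` (`Σ_i |blk n (p ± e_μ) i − blk n p i| ≤ 1` on `ℤ^d`), `torusBlock_step_le_one` (`ρ(tb(x ± ê_μ), tb x) ≤ 1`),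
  `torusBlock_of_mem` (`q ∈ B n (blk n (wm x))` ⟹ `tb(σ q) = tb x`).
* §3 **`torus_form_blockLocal`** (ANY `H_φ` with the displayed pairing has block range `1` in (273)'s bilinear sense),
  **`torus_form_blockCeiling`** (`a ≥ 0`, `u″ ≤ Λ` ⟹ `H_φ h h ≤ (4d(n+1)² + a + Λ)Σh²`).
* §4 THE END **`torus_fibre_covariance_frd`**: `0 < a`, `0 ≤ Λ`, `−λ ≤ u″(φ x) ≤ Λ`, `λ < min(2,a)` ⟹ `∃ P H_φ` ((279)'s clauses (i)–(v);
  the displayed pairing, symmetric, floor) such that, with `M_z(j,k) = H_φ(Pe_j)(Pe_k)` and `C(x,y) = Σ_{jk}(Pe_j)_x(M_z⁻¹)_{jk}(Pe_k)_y`: `C·g`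
  has zero block means and solves (101)'s fibre equation for every `g`; and for every `J`, `C = Σ_{N<J}Γ_N + Γ_J^{rem}` entrywise with `Γ_N`
  positive semidefinite of block range `2(2^N − 1)` (for `ρ(tb x, tb y)`) and `Γ_J^{rem}` positive semidefinite; §5 toy.

HONEST (what this is NOT).  Plumbing by name; no size of the pieces; block distance (not site distance — inside a block all ranges are
free); cubic periods; scalar skeleton ((A3), NC-NE7b-α UNRULED); nothing of Bałaban's asserted.  BY-NAME EFFECT ON THE WALL: NONE.  NE7b NOT
PRINTED ∕ NOT PROVED; spine PROVED 0∕9; rung (B)+1 on a FINITE torus — NOT infinite volume, NOT the mass gap, NOT Clay.  HONEST DEPENDENCY: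
continuum YM on T⁴ ⇐ BetaPertH ∧ nine spine estimates (0∕9 proved); BetaPertH ⇐ (D1) ∧ (D4) ∧ CAP+tail; G-an2-4 gates asym, D1 and
NE2∕3∕4.
-/

set_option autoImplicit false

noncomputable section

namespace Summit.QuantumFields.BalabanUV.T4Continuum.NE7b.SupTorusFibreFiniteRangeDecomposition

open Real Matrix
open scoped ENNReal
open Literature.MathematicalPhysics.QuantumFieldTheory.Balaban1983to89
open Literature.Analysis.Matrix (HasFiniteRange frdPiece frdRemainder)
open B6QGQLower276 (X e blk B side AX chart chart_mem_B mem_B)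
open B5Hk103ScalarZd (nbhd)
open Beta (Site siteOf windowMap siteOf_windowMap siteOf_add)
open SupTorusDirichletForm (blockOf_siteOf blockOf_siteOf_of_mem)
open SupTorusDirichletFormCoercive (torus_operator_apply)
open SupTorusFormCeiling (torus_form_ceiling)
open SupTorusBlockDistance (natAbs_valMinAbs_le_of_intCast_eq natAbs_valMinAbs_add_le')
open SupFibreGaussianCovariance (covariance_mem_fibre covariance_fibre_equation)
open SupFibreFiniteRangeRemainder (fibre_covariance_frd_psd)
open SupTorusFibreGaussianCovariance (torus_linearised_form)
open SupTorusFibreChartLocal (exists_fibreChart_local)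

variable {d : ℕ}

/-! ## §1. The `ℓ¹` block distance on the coarse torus is an `ℕ`-valued pseudo-distance -/

section Dist

variable {s : ℕ} [NeZero s]

omit [NeZero s] in
/-- Triangle inequality of `ρ(u,v) = Σ_i |valMinAbs(u_i − v_i)|`. [folklore] -/
theorem blockDist_triangle (u v w : Site d s) :
    ∑ i, ((u i - w i).valMinAbs.natAbs) ≤ ∑ i, ((u i - v i).valMinAbs.natAbs) + ∑ i, ((v i - w i).valMinAbs.natAbs) := by
  rw [← Finset.sum_add_distrib]
  refine Finset.sum_le_sum fun i _ => ?_
  have h := natAbs_valMinAbs_add_le' (u i - v i) (v i - w i)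
  rwa [sub_add_sub_cancel] at h

omit [NeZero s] in
/-- Symmetry of `ρ`. [folklore] -/
theorem blockDist_comm (u v : Site d s) :
    ∑ i, ((u i - v i).valMinAbs.natAbs) = ∑ i, ((v i - u i).valMinAbs.natAbs) :=
  Finset.sum_congr rfl fun i _ => by rw [← neg_sub, ZMod.natAbs_valMinAbs_neg]

omit [NeZero s] in
/-- `ρ(u,u) = 0`. [folklore] -/
theorem blockDist_self (u : Site d s) : ∑ i, ((u i - u i).valMinAbs.natAbs) = 0 :=
  Finset.sum_eq_zero fun i _ => by rw [sub_self, ZMod.valMinAbs_zero, Int.natAbs_zero]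

end Dist

/-! ## §2. Block steps: one bond moves the block by at most one; block averaging stays in the block -/

/-- **ONE BOND STEP MOVES THE LATTICE BLOCK BY AT MOST ONE** (`ℓ¹` over the coordinates): `Σ_i |blk n (p + e_μ) i − blk n p i| ≤ 1` and the
same for `p − e_μ`. [folklore] -/
theorem blk_step_le_one (n : ℕ) (p : X d) (μ : Fin d) :
    (∑ i, (blk n (p + e μ) i - blk n p i).natAbs) ≤ 1 ∧ (∑ i, (blk n (p - e μ) i - blk n p i).natAbs) ≤ 1 := by
  have hN : (0 : ℤ) < side n := (B6QGQLower276.side_facts n).1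
  have hoff : ∀ i, i ≠ μ → (blk n (p + e μ) i - blk n p i).natAbs = 0 ∧ (blk n (p - e μ) i - blk n p i).natAbs = 0 := by
    intro i hi
    simp only [blk, Pi.add_apply, Pi.sub_apply, e, Pi.single_eq_of_ne hi, add_zero, sub_zero, sub_self, Int.natAbs_zero, and_self]
  have hup : (blk n (p + e μ) μ - blk n p μ).natAbs ≤ 1 := by
    simp only [blk, Pi.add_apply, e, Pi.single_eq_same]
    have h1 : p μ / side n ≤ (p μ + 1) / side n := Int.ediv_le_ediv hN (by omega)
    have h2 : (p μ + 1) / side n ≤ (p μ + 1 * side n) / side n := Int.ediv_le_ediv hN (by nlinarith)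
    have h3 : (p μ + 1 * side n) / side n = p μ / side n + 1 := Int.add_mul_ediv_right _ 1 hN.ne'
    omega
  have hdown : (blk n (p - e μ) μ - blk n p μ).natAbs ≤ 1 := by
    simp only [blk, Pi.sub_apply, e, Pi.single_eq_same]
    have h1 : (p μ - 1) / side n ≤ p μ / side n := Int.ediv_le_ediv hN (by omega)
    have h2 : p μ / side n ≤ (p μ - 1 + 1 * side n) / side n := Int.ediv_le_ediv hN (by nlinarith)
    have h3 : (p μ - 1 + 1 * side n) / side n = (p μ - 1) / side n + 1 := Int.add_mul_ediv_right _ 1 hN.ne'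
    omega
  constructor
  · rw [Finset.sum_eq_single μ (fun i _ hi => (hoff i hi).1) (fun h => absurd (Finset.mem_univ μ) h)]
    exact hup
  · rw [Finset.sum_eq_single μ (fun i _ hi => (hoff i hi).2) (fun h => absurd (Finset.mem_univ μ) h)]
    exact hdown

section Torus

variable (n : ℕ) (s : ℕ) [NeZero s]

/-- The `valMinAbs` block distance between the torus blocks of `σ q` and `x` is at most the lattice block difference of `q` and the window
representative of `x`. [folklore] -/
theorem torusBlock_dist_le (q : X d) (x : Site d ((n + 1) * s)) :
    (∑ i, (siteOf d s (blk n (windowMap d ((n + 1) * s) (siteOf d ((n + 1) * s) q))) i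
        - siteOf d s (blk n (windowMap d ((n + 1) * s) x)) i).valMinAbs.natAbs)
      ≤ ∑ i, (blk n q i - blk n (windowMap d ((n + 1) * s) x) i).natAbs := by
  rw [blockOf_siteOf]
  refine Finset.sum_le_sum fun i _ => natAbs_valMinAbs_le_of_intCast_eq _ _ ?_
  simp [siteOf, Int.cast_sub]

/-- **ONE BOND STEP ON THE FINE TORUS MOVES THE TORUS BLOCK BY AT MOST ONE.** [folklore] -/
theorem torusBlock_step_le_one (x : Site d ((n + 1) * s)) (μ : Fin d) :
    (∑ i, ((siteOf d s (blk n (windowMap d ((n + 1) * s) (x + siteOf d ((n + 1) * s) (e μ)))) i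
        - (siteOf d s (blk n (windowMap d ((n + 1) * s) x))) i).valMinAbs.natAbs)) ≤ 1 ∧
    (∑ i, ((siteOf d s (blk n (windowMap d ((n + 1) * s) (x - siteOf d ((n + 1) * s) (e μ)))) i
        - (siteOf d s (blk n (windowMap d ((n + 1) * s) x))) i).valMinAbs.natAbs)) ≤ 1 := by
  haveI : NeZero ((n + 1) * s) := ⟨Nat.mul_ne_zero (Nat.succ_ne_zero n) (NeZero.ne s)⟩
  have hx : x = siteOf d ((n + 1) * s) (windowMap d ((n + 1) * s) x) := (siteOf_windowMap d ((n + 1) * s) x).symm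
  have hadd : x + siteOf d ((n + 1) * s) (e μ) = siteOf d ((n + 1) * s) (windowMap d ((n + 1) * s) x + e μ) := by
    conv_lhs => rw [hx]
    rw [siteOf_add]
  have hsub : x - siteOf d ((n + 1) * s) (e μ) = siteOf d ((n + 1) * s) (windowMap d ((n + 1) * s) x - e μ) := by
    conv_lhs => rw [hx]
    funext i
    simp [siteOf, Int.cast_sub]
  obtain ⟨h1, h2⟩ := blk_step_le_one n (windowMap d ((n + 1) * s) x) μ
  constructor
  · rw [hadd]
    exact (torusBlock_dist_le n s _ x).trans h1
  · rw [hsub]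
    exact (torusBlock_dist_le n s _ x).trans h2

/-- **BLOCK AVERAGING STAYS IN THE BLOCK**: `q ∈ B n (blk n (wm x))` ⟹ the torus block of `σ q` is that of `x`. [folklore] -/
theorem torusBlock_of_mem (x : Site d ((n + 1) * s)) {q : X d} (hq : q ∈ B n (blk n (windowMap d ((n + 1) * s) x))) :
    siteOf d s (blk n (windowMap d ((n + 1) * s) (siteOf d ((n + 1) * s) q))) = siteOf d s (blk n (windowMap d ((n + 1) * s) x)) := by
  rw [blockOf_siteOf, mem_B.1 hq]

end Torus

/-! ## §3. The road's linearised form: block range one, volume-free ceiling -/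

section Form

variable (n : ℕ) (a : ℝ) (s : ℕ) [NeZero s]
  {Dop Aop : lp (fun _ : X d => ℝ) ∞ →L[ℝ] lp (fun _ : X d => ℝ) ∞}
  (hA : ∀ (f : lp (fun _ : X d => ℝ) ∞) (p : X d), Aop f p = ∑ r ∈ nbhd n p, AX n a p r * f r)
  (hD : ∀ (f : lp (fun _ : X d => ℝ) ∞) (y : X d), Dop f y = (((n : ℝ) + 1) ^ d)⁻¹ * ∑ p ∈ B n y, f p)
  {Ef : (Site d ((n + 1) * s) → ℝ) →L[ℝ] lp (fun _ : X d => ℝ) ∞}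
  (hEf : ∀ (g : Site d ((n + 1) * s) → ℝ) (q : X d), Ef g q = g (siteOf d ((n + 1) * s) q))
  {Rf : lp (fun _ : X d => ℝ) ∞ →L[ℝ] (Site d ((n + 1) * s) → ℝ)}
  (hRf : ∀ (h : lp (fun _ : X d => ℝ) ∞) (x : Site d ((n + 1) * s)), Rf h x = h (windowMap d ((n + 1) * s) x))
  {Rc : lp (fun _ : X d => ℝ) ∞ →L[ℝ] (Site d s → ℝ)}
  (hRc : ∀ (h : lp (fun _ : X d => ℝ) ∞) (x : Site d s), Rc h x = h (windowMap d s x))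

include hA hEf hRf in
/-- **THE LINEARISED FORM HAS BLOCK RANGE ONE**: for ANY `H_φ` with `H_φ h k = Σ_x ((A_t h) x + u″(φ x)h x)k x`, if every site where `h ≠ 0` is
more than one block away from every site where `k ≠ 0`, then `H_φ h k = 0`. [folklore] -/
theorem torus_form_blockLocal {u' : ℝ → ℝ} {φ : Site d ((n + 1) * s) → ℝ}
    (Hφ : (Site d ((n + 1) * s) → ℝ) →L[ℝ] (Site d ((n + 1) * s) → ℝ) →L[ℝ] ℝ)
    (hH : ∀ h k, Hφ h k = ∑ x, (((Rf.comp Aop).comp Ef) h x + u' (φ x) * h x) * k x) (h k : Site d ((n + 1) * s) → ℝ)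
    (hfar : ∀ x y, h x ≠ 0 → k y ≠ 0 →
      1 < ∑ i, ((siteOf d s (blk n (windowMap d ((n + 1) * s) x))) i
        - (siteOf d s (blk n (windowMap d ((n + 1) * s) y))) i).valMinAbs.natAbs) :
    Hφ h k = 0 := by
  rw [hH]
  refine Finset.sum_eq_zero fun x _ => ?_
  rcases eq_or_ne (k x) 0 with hkx | hkx
  · rw [hkx, mul_zero]
  -- every value of `h` entering the `x`-term vanishes
  have hzero : ∀ y, (∑ i, ((siteOf d s (blk n (windowMap d ((n + 1) * s) y))) i
      - (siteOf d s (blk n (windowMap d ((n + 1) * s) x))) i).valMinAbs.natAbs) ≤ 1 → h y = 0 := fun y hy => by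
    by_contra hy'
    exact absurd (hfar y x hy' hkx) (not_lt.2 hy)
  have hx0 : h x = 0 := hzero x (by rw [blockDist_self]; exact zero_le_one)
  have hplus : ∀ μ, h (x + siteOf d ((n + 1) * s) (e μ)) = 0 := fun μ => hzero _ (torusBlock_step_le_one n s x μ).1
  have hminus : ∀ μ, h (x - siteOf d ((n + 1) * s) (e μ)) = 0 := fun μ => hzero _ (torusBlock_step_le_one n s x μ).2
  have hblock : ∀ q ∈ B n (blk n (windowMap d ((n + 1) * s) x)), h (siteOf d ((n + 1) * s) q) = 0 := fun q hq =>
    hzero _ (by rw [torusBlock_of_mem n s x hq, blockDist_self]; exact zero_le_one)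
  have hop : ((Rf.comp Aop).comp Ef) h x = 0 := by
    rw [ContinuousLinearMap.comp_apply, ContinuousLinearMap.comp_apply, torus_operator_apply n a s hA hEf hRf h x]
    simp only [hx0, hplus, hminus, mul_zero, sub_self, Finset.sum_const_zero, zero_add]
    rw [Finset.sum_eq_zero hblock, mul_zero]
  rw [hop, hx0, mul_zero, add_zero, zero_mul]

include hA hEf hRf in
/-- **THE VOLUME-FREE CEILING OF THE LINEARISED FORM**: `a ≥ 0`, `u″(φ x) ≤ Λ` ⟹ `Σ_x ((A_t h) x + u″(φ x)h x)h x ≤ (4d(n+1)² + a + Λ)Σh²`.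
[folklore] -/
theorem torus_form_blockCeiling (ha : 0 ≤ a) {u' : ℝ → ℝ} {Lam : ℝ} {φ : Site d ((n + 1) * s) → ℝ} (hu'Λ : ∀ x, u' (φ x) ≤ Lam)
    (h : Site d ((n + 1) * s) → ℝ) :
    ∑ x, (((Rf.comp Aop).comp Ef) h x + u' (φ x) * h x) * h x ≤ (4 * d * ((n : ℝ) + 1) ^ 2 + a + Lam) * ∑ x, h x ^ 2 := by
  have h1 : ∑ x, (((Rf.comp Aop).comp Ef) h x + u' (φ x) * h x) * h x
      = ∑ x, h x * ((Rf.comp Aop).comp Ef) h x + ∑ x, u' (φ x) * h x ^ 2 := by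
    rw [← Finset.sum_add_distrib]
    exact Finset.sum_congr rfl fun x _ => by ring
  have h2 := torus_form_ceiling n a s hA hEf hRf ha h
  have h3 : ∑ x, u' (φ x) * h x ^ 2 ≤ Lam * ∑ x, h x ^ 2 := by
    rw [Finset.mul_sum]
    exact Finset.sum_le_sum fun x _ => mul_le_mul_of_nonneg_right (hu'Λ x) (sq_nonneg _)
  calc ∑ x, (((Rf.comp Aop).comp Ef) h x + u' (φ x) * h x) * h x
      = ∑ x, h x * ((Rf.comp Aop).comp Ef) h x + ∑ x, u' (φ x) * h x ^ 2 := h1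
    _ ≤ (4 * d * ((n : ℝ) + 1) ^ 2 + a) * ∑ x, h x ^ 2 + Lam * ∑ x, h x ^ 2 := add_le_add h2 h3
    _ = (4 * d * ((n : ℝ) + 1) ^ 2 + a + Lam) * ∑ x, h x ^ 2 := by ring

/-! ## §4. THE END: the finite-range decomposition of the road's fluctuation covariance on the torus -/

include hA hD hEf hRf hRc in
/-- **HEADLINE — THE TORUS FLUCTUATION COVARIANCE AT `φ` IS A SUM OF `J + 1` COVARIANCES, `J` OF FINITE BLOCK RANGE.**  `0 < a`, `0 ≤ Λ`,
`−λ ≤ u″(φ x) ≤ Λ` at every fine torus site, `λ < min(2,a)` ⟹ `∃ P H_φ`: `P` is (279)'s block chart (zero block means, bound `1`, ceiling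
`(n+1)^d + 1`, onto the fibre, block-local); `H_φ` the road's linearised form (displayed pairing, symmetric, floor `min(2,a) − λ`); and for ANY
`M_z` with `M_z(j,k) = H_φ(Pe_j)(Pe_k)`, `C(x,y) = Σ_{jk}(Pe_j)_x(M_z⁻¹)_{jk}(Pe_k)_y`, `c = 4∕((4d(n+1)² + a + Λ)((n+1)^d + 1))`: `C·g` has zero block means
and solves (101)'s fibre equation for every `g`, and for every `J`, `C = Σ_{N<J}Γ_N + Γ_J^{rem}` entrywise, `Γ_N = Γ(c·C_N(cM_z))` positive
semidefinite of block range `2(2^N − 1)`, `Γ_J^{rem} = Γ(M_z⁻¹R_J(cM_z))` positive semidefinite. [folklore] -/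
theorem torus_fibre_covariance_frd (ha : 0 < a) {u' : ℝ → ℝ} {lam Lam : ℝ} {φ : Site d ((n + 1) * s) → ℝ} (hLam : 0 ≤ Lam)
    (hu' : ∀ x, -lam ≤ u' (φ x)) (hu'Λ : ∀ x, u' (φ x) ≤ Lam) (hγ : lam < min 2 a) :
    ∃ (P : ((Site d s × {z : Fin d → Fin (n + 1) // z ≠ 0}) → ℝ) →L[ℝ] (Site d ((n + 1) * s) → ℝ))
      (Hφ : (Site d ((n + 1) * s) → ℝ) →L[ℝ] (Site d ((n + 1) * s) → ℝ) →L[ℝ] ℝ),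
      -- the chart ((279))
      (∀ ζ, ((Rc.comp Dop).comp Ef) (P ζ) = 0) ∧
      (∀ ζ, (1 : ℝ) * ∑ i, ζ i ^ 2 ≤ ∑ x, P ζ x ^ 2) ∧
      (∀ ζ, ∑ x, P ζ x ^ 2 ≤ (((n : ℝ) + 1) ^ d + 1) * ∑ i, ζ i ^ 2) ∧
      (∀ h : Site d ((n + 1) * s) → ℝ, ((Rc.comp Dop).comp Ef) h = 0 → ∃ ζ, P ζ = h) ∧
      (∀ (j : Site d s × {z : Fin d → Fin (n + 1) // z ≠ 0}) (x : Site d ((n + 1) * s)),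
        siteOf d s (blk n (windowMap d ((n + 1) * s) x)) ≠ j.1 → P (Pi.single j 1) x = 0) ∧
      -- the form ((274))
      (∀ h k, Hφ h k = ∑ x, (((Rf.comp Aop).comp Ef) h x + u' (φ x) * h x) * k x) ∧
      (∀ h k, Hφ h k = Hφ k h) ∧
      (∀ h, (min 2 a - lam) * ∑ x, h x ^ 2 ≤ Hφ h h) ∧
      -- the covariance `C = PM_z⁻¹Pᵀ` for ANY matrix with the displayed entries: the road's object, and its decomposition
      ∀ Mz : Matrix (Site d s × {z : Fin d → Fin (n + 1) // z ≠ 0}) (Site d s × {z : Fin d → Fin (n + 1) // z ≠ 0}) ℝ,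
        (∀ j k, Mz j k = Hφ (P (Pi.single j 1)) (P (Pi.single k 1))) →
        (∀ g : Site d ((n + 1) * s) → ℝ,
          ((Rc.comp Dop).comp Ef) (fun x => ∑ y, (∑ j, ∑ k, P (Pi.single j 1) x * Mz⁻¹ j k * P (Pi.single k 1) y) * g y) = 0 ∧
          ∀ ζ, Hφ (fun x => ∑ y, (∑ j, ∑ k, P (Pi.single j 1) x * Mz⁻¹ j k * P (Pi.single k 1) y) * g y) (P ζ)
            = ∑ y, g y * P ζ y) ∧
        -- the finite-range decomposition, every `J`
        (∀ J : ℕ,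
          (∀ x y, (∑ j, ∑ k, P (Pi.single j 1) x * Mz⁻¹ j k * P (Pi.single k 1) y)
            = (∑ N ∈ Finset.range J, ∑ j, ∑ k, P (Pi.single j 1) x
                * (((4 / ((4 * d * ((n : ℝ) + 1) ^ 2 + a + Lam) * (((n : ℝ) + 1) ^ d + 1)) : ℝ))
                  • frdPiece (((4 / ((4 * d * ((n : ℝ) + 1) ^ 2 + a + Lam) * (((n : ℝ) + 1) ^ d + 1)) : ℝ)) • Mz) N) j k
                * P (Pi.single k 1) y)
              + ∑ j, ∑ k, P (Pi.single j 1) x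
                * (Mz⁻¹ * frdRemainder (((4 / ((4 * d * ((n : ℝ) + 1) ^ 2 + a + Lam) * (((n : ℝ) + 1) ^ d + 1)) : ℝ)) • Mz) J) j k
                * P (Pi.single k 1) y) ∧
          (∀ N, (Matrix.of fun x y => ∑ j, ∑ k, P (Pi.single j 1) x
              * (((4 / ((4 * d * ((n : ℝ) + 1) ^ 2 + a + Lam) * (((n : ℝ) + 1) ^ d + 1)) : ℝ))
                • frdPiece (((4 / ((4 * d * ((n : ℝ) + 1) ^ 2 + a + Lam) * (((n : ℝ) + 1) ^ d + 1)) : ℝ)) • Mz) N) j k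
              * P (Pi.single k 1) y).PosSemidef ∧
            HasFiniteRange (fun x y : Site d ((n + 1) * s) => ∑ i, ((siteOf d s (blk n (windowMap d ((n + 1) * s) x))) i
                - (siteOf d s (blk n (windowMap d ((n + 1) * s) y))) i).valMinAbs.natAbs) (0 + 2 * (2 ^ N - 1) * (0 + 1 + 0) + 0)
              (Matrix.of fun x y => ∑ j, ∑ k, P (Pi.single j 1) x
                * (((4 / ((4 * d * ((n : ℝ) + 1) ^ 2 + a + Lam) * (((n : ℝ) + 1) ^ d + 1)) : ℝ))
                  • frdPiece (((4 / ((4 * d * ((n : ℝ) + 1) ^ 2 + a + Lam) * (((n : ℝ) + 1) ^ d + 1)) : ℝ)) • Mz) N) j k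
                * P (Pi.single k 1) y)) ∧
          (Matrix.of fun x y => ∑ j, ∑ k, P (Pi.single j 1) x
              * (Mz⁻¹ * frdRemainder (((4 / ((4 * d * ((n : ℝ) + 1) ^ 2 + a + Lam) * (((n : ℝ) + 1) ^ d + 1)) : ℝ)) • Mz) J) j k
              * P (Pi.single k 1) y).PosSemidef) := by
  classical
  obtain ⟨P, hQP, hPlow, hPup, hPsurj, hPloc, -⟩ := exists_fibreChart_local n s hD hEf hRc
  obtain ⟨Hφ, hH, hHsym, hfl⟩ := torus_linearised_form n a s hA hEf hRf hu'
  have hm : 0 < min 2 a - lam := sub_pos.2 hγ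
  have hΛH : 0 < 4 * d * ((n : ℝ) + 1) ^ 2 + a + Lam := by positivity
  have hq : (0 : ℝ) < ((n : ℝ) + 1) ^ d + 1 := by positivity
  have hceil : ∀ h, Hφ h h ≤ (4 * d * ((n : ℝ) + 1) ^ 2 + a + Lam) * ∑ x, h x ^ 2 := fun h => by
    rw [hH]; exact torus_form_blockCeiling n a s hA hEf hRf ha.le hu'Λ h
  -- the chart's locality with radius `0` about the home sites `σ(chart n (wm j.1) j.2)`
  have hPloc' : ∀ (j : Site d s × {z : Fin d → Fin (n + 1) // z ≠ 0}) (x : Site d ((n + 1) * s)),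
      0 < (∑ i, (siteOf d s (blk n (windowMap d ((n + 1) * s)
        (siteOf d ((n + 1) * s) (chart n (windowMap d s j.1) j.2.1)))) i
        - siteOf d s (blk n (windowMap d ((n + 1) * s) x)) i).valMinAbs.natAbs) → P (Pi.single j 1) x = 0 := by
    intro j x hpos
    refine hPloc j x fun hx => ?_
    rw [blockOf_siteOf_of_mem n s (chart_mem_B n (windowMap d s j.1) j.2.1), ← hx, blockDist_self] at hpos
    exact lt_irrefl 0 hpos
  have hHloc : ∀ h k : Site d ((n + 1) * s) → ℝ, (∀ x y, h x ≠ 0 → k y ≠ 0 →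
      1 < ∑ i, ((siteOf d s (blk n (windowMap d ((n + 1) * s) x))) i
        - (siteOf d s (blk n (windowMap d ((n + 1) * s) y))) i).valMinAbs.natAbs) → Hφ h k = 0 :=
    fun h k hfar => torus_form_blockLocal n a s hA hEf hRf Hφ hH h k hfar
  refine ⟨P, Hφ, hQP, hPlow, hPup, hPsurj, hPloc, hH, hHsym, hfl, fun Mz hMz => ⟨fun g => ?_, fun J => ?_⟩⟩
  · -- `C·g` is in the fibre and solves the road's fibre equation ((271) by name)
    refine ⟨?_, fun ζ => covariance_fibre_equation P hHsym hfl hm hPlow one_pos Mz hMz g ζ⟩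
    rw [← covariance_mem_fibre P Mz g]
    exact hQP _
  · exact fibre_covariance_frd_psd P hHsym hfl hm hceil hΛH hPlow one_pos hPup hq
      (fun x y w => blockDist_triangle _ _ _) (fun x y => blockDist_comm _ _) (fun x => blockDist_self _) hHloc hPloc' Mz hMz J

end Form

/-! ## §5. Toy -/

/-- Toy: on `ℤ¹` with blocks of side `2`, one step from site `1` to site `2` crosses a block boundary (block `0` to block `1`), so the block
moves by exactly one — the extremal case of `blk_step_le_one`. -/
example : (∑ i : Fin 1, (blk 1 ((fun _ => (1 : ℤ)) + e (0 : Fin 1)) i - blk 1 (fun _ : Fin 1 => (1 : ℤ)) i).natAbs) ≤ 1 :=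
  (blk_step_le_one (d := 1) 1 (fun _ => 1) 0).1

end Summit.QuantumFields.BalabanUV.T4Continuum.NE7b.SupTorusFibreFiniteRangeDecomposition
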